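import Literature.Probability.RandomPlanarGeometry.SLEPointFlow
import Literature.Analysis.FunctionSpaces.ItoProcessesProofs
import Literature.Probability.Process.ProgressiveDensity
import HarnessLib

/-!
# The localized SLE_κ point flow: stopped processes, truncated coefficients, bounds, measurability

Topic `Probability/RandomPlanarGeometry`; step S3a of the discharge of Rohde–Schramm's Lemma 6.3
(`κ < 8`; named fact `Literature.Probability.RandomPlanarGeometry.exists_tendsto_sleDerivRatio_of_lt_eight`).
With the localizing stopping times `ρₙ = slePointLocTime κ z n` of `SLEPointFlow.lean` we form the
processes `X = x^{ρₙ}`, `Y = y^{ρₙ}` of Rohde–Schramm's flow `zₜ = xₜ + i yₜ = gₜ(z) - Wₜ`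
**stopped at `ρₙ`** (Mathlib `MeasureTheory.stoppedProcess`; this is *not* the freezing at the
swallowing time of `Loewner.imFlowStop` / `sleRealFlowStop` — here `ρₙ < τ(z)`), and the
**truncated coefficient processes** (`Literature.Analysis.FunctionSpaces.trunc ρₙ`) of their Itô
calculus:

* `slePointReDrift` — `𝟙_{s ≤ ρₙ} 2xₛ/|zₛ|²` (the drift of `x`: "`dxₜ = 2xₜ|zₜ|⁻² dt - dξ(t)`",
  Rohde–Schramm (2005), p. 907), `slePointInvImRate` — `𝟙_{s ≤ ρₙ} 2/(yₛ|zₛ|²)` (the derivative of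
  `1/yₜ`, from `ẏ = -2y/|z|²`), `slePointRatioRate` — `𝟙_{s ≤ ρₙ} 4yₛ²/|zₛ|⁴` (the derivative of
  `log ψₜ`, (6.4)), and the constant diffusion coefficient `slePointDiffusion = 𝟙_{s ≤ ρₙ}(-√κ)`,
  all written in terms of `X`, `Y` and `Q = X² + Y² = |z|²` (so that the untruncated integrands
  are continuous paths; for `s ≤ ρₙ` they are the integrands of `Loewner.re_map_eq_add_integral`,
  `Loewner.inv_im_map_eq_add_integral` and `Loewner.derivRatioRate`, and `Q = |zₛ|²`,
  `slePointNormSqStop_eq_of_le`);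
* **pathwise facts** (every `ω`, every `t`): continuity of `X`, `Y`, `Q` and of the untruncated
  integrands; local integrability of the truncated coefficients; the bounds
  `im z/(n+2) ≤ Y ≤ im z`, `Q ≥ (im z/(n+2))²`, `|𝟙 2X/Q| ≤ (n+2)/im z` (AM–GM),
  `|𝟙 2/(YQ)| ≤ 2((n+2)/im z)³`, `0 ≤ 𝟙 4Y²/Q² ≤ 4((n+2)/im z)²`, `|σ| ≤ √κ`;
* **measurability**: `X`, `Y` are strongly adapted to the raw Brownian filtration with continuous
  paths (hence progressive), and `Q` and the coefficient processes are progressive.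

The integral identities (`X_t = re z + ∫₀ᵗ drift − W_{t∧ρₙ}`, `1/Y`, `ψ^a`) and the Itô-process
statement for `X` are the next step (S3b, `SLEPointFlowIto.lean`).

## References

* S. Rohde, O. Schramm, *Basic properties of SLE*, Ann. of Math. 161 (2005), proof of Lemma 6.3
  (pp. 904–905, eqs. (6.3), (6.4)) and of Lemma 6.5 (p. 907).
* D. Revuz, M. Yor, *Continuous Martingales and Brownian Motion* (1999), Ch. IV §§1–3.
-/

noncomputable section

open Set Filter MeasureTheory Metric Complex
open _root_.Topology
open scoped NNReal

namespace Literature.Probability.RandomPlanarGeometry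

open Loewner Literature.Probability.Process Literature.Analysis.FunctionSpaces

variable (κ : ℝ≥0) (z : ℂ) (n : ℕ)

/-! ### The stopped processes and the truncated coefficients -/

/-- `X = x^{ρₙ}`: the real part of the centred SLE_κ flow of `z`, stopped at the localizing time
`ρₙ`. [cite: RohdeSchramm2005, Lemma 6.3 (proof)] -/
def slePointReStop : ℝ≥0 → (ℝ≥0 → ℝ) → ℝ :=
  stoppedProcess (slePointRe κ z) (slePointLocTime κ z n)

/-- `Y = y^{ρₙ}`: the imaginary part of the SLE_κ flow of `z`, stopped at `ρₙ`.
[cite: RohdeSchramm2005, Lemma 6.3 (proof)] -/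
def slePointImStop : ℝ≥0 → (ℝ≥0 → ℝ) → ℝ :=
  stoppedProcess (slePointIm κ z) (slePointLocTime κ z n)

/-- `Q = X² + Y² = |z_{t∧ρₙ}|²`. [folklore] -/
def slePointNormSqStop (t : ℝ≥0) (ω : ℝ≥0 → ℝ) : ℝ :=
  slePointReStop κ z n t ω ^ 2 + slePointImStop κ z n t ω ^ 2

/-- The truncated drift `𝟙_{s ≤ ρₙ} 2xₛ/|zₛ|²` of `x` ("`dxₜ = 2xₜ|zₜ|⁻² dt - dξ(t)`").
[cite: RohdeSchramm2005, Lemma 6.5 (proof)] -/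
def slePointReDrift : ℝ≥0 → (ℝ≥0 → ℝ) → ℝ :=
  trunc (slePointLocTime κ z n) fun s ω ↦ 2 * slePointReStop κ z n s ω / slePointNormSqStop κ z n s ω

/-- The truncated (constant) diffusion coefficient `𝟙_{s ≤ ρₙ} (-√κ)` of `x`. [folklore] -/
def slePointDiffusion : ℝ≥0 → (ℝ≥0 → ℝ) → ℝ :=
  trunc (slePointLocTime κ z n) fun _ _ ↦ -Real.sqrt κ

/-- The truncated rate `𝟙_{s ≤ ρₙ} 2/(yₛ|zₛ|²)` of `1/yₜ` (`∂ₜ(1/y) = 2/(y|z|²)` from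
`ẏ = -2y/|z|²`). [cite: RohdeSchramm2005, Lemma 6.3 (proof)] -/
def slePointInvImRate : ℝ≥0 → (ℝ≥0 → ℝ) → ℝ :=
  trunc (slePointLocTime κ z n) fun s ω ↦
    2 / (slePointImStop κ z n s ω * slePointNormSqStop κ z n s ω)

/-- The truncated rate `𝟙_{s ≤ ρₙ} 4yₛ²/|zₛ|⁴` of `log ψₜ` ((6.4)).
[cite: RohdeSchramm2005, Lemma 6.3 (proof)] -/
def slePointRatioRate : ℝ≥0 → (ℝ≥0 → ℝ) → ℝ :=
  trunc (slePointLocTime κ z n) fun s ω ↦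
    4 * slePointImStop κ z n s ω ^ 2 / slePointNormSqStop κ z n s ω ^ 2

variable {κ z n}

/-! ### The stopped clock -/

/-- The stopped clock `t ∧ ρₙ(ω)` read in `ℝ≥0`. [folklore] -/
theorem slePointClock_le_locTime (t : ℝ≥0) (ω : ℝ≥0 → ℝ) :
    (((min (t : WithTop ℝ≥0) (slePointLocTime κ z n ω)).untopA : ℝ≥0) : WithTop ℝ≥0) ≤
      slePointLocTime κ z n ω :=
  coe_untopA_min_le t _

/-- The stopped clock is before the swallowing time. [folklore] -/
theorem slePointClock_lt_swallowingTime (hz : 0 < z.im) (t : ℝ≥0) (ω : ℝ≥0 → ℝ) :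
    (((min (t : WithTop ℝ≥0) (slePointLocTime κ z n ω)).untopA : ℝ≥0) : WithTop ℝ≥0) <
      swallowingTime (sleDriving κ ω) z :=
  coe_lt_swallowingTime_of_le_locTime hz (slePointClock_le_locTime t ω)

/-- Unfolding of `X`. [folklore] -/
theorem slePointReStop_apply (t : ℝ≥0) (ω : ℝ≥0 → ℝ) :
    slePointReStop κ z n t ω =
      slePointRe κ z ((min (t : WithTop ℝ≥0) (slePointLocTime κ z n ω)).untopA) ω := rfl

/-- Unfolding of `Y`. [folklore] -/
theorem slePointImStop_apply (t : ℝ≥0) (ω : ℝ≥0 → ℝ) :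
    slePointImStop κ z n t ω =
      slePointIm κ z ((min (t : WithTop ℝ≥0) (slePointLocTime κ z n ω)).untopA) ω := rfl

/-- Before `ρₙ`, `X = x`. [folklore] -/
theorem slePointReStop_eq_of_le {t : ℝ≥0} {ω : ℝ≥0 → ℝ}
    (h : (t : WithTop ℝ≥0) ≤ slePointLocTime κ z n ω) : slePointReStop κ z n t ω = slePointRe κ z t ω :=
  stoppedProcess_eq_of_le h

/-- Before `ρₙ`, `Y = y`. [folklore] -/
theorem slePointImStop_eq_of_le {t : ℝ≥0} {ω : ℝ≥0 → ℝ}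
    (h : (t : WithTop ℝ≥0) ≤ slePointLocTime κ z n ω) : slePointImStop κ z n t ω = slePointIm κ z t ω :=
  stoppedProcess_eq_of_le h

/-- `Q = |z_{t∧ρₙ}|²`. [folklore] -/
theorem slePointNormSqStop_eq (hz : 0 < z.im) (t : ℝ≥0) (ω : ℝ≥0 → ℝ) :
    slePointNormSqStop κ z n t ω = Complex.normSq (centredMap (sleDriving κ ω)
      ((min (t : WithTop ℝ≥0) (slePointLocTime κ z n ω)).untopA) z) := by
  rw [slePointNormSqStop, slePointReStop_apply, slePointImStop_apply,
    slePointIm_of_lt (slePointClock_lt_swallowingTime hz t ω), Complex.normSq_apply, slePointRe]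
  ring

/-- Before `ρₙ`, `Q = |zₛ|²`. [folklore] -/
theorem slePointNormSqStop_eq_of_le (hz : 0 < z.im) {s : ℝ≥0} {ω : ℝ≥0 → ℝ}
    (h : (s : WithTop ℝ≥0) ≤ slePointLocTime κ z n ω) :
    slePointNormSqStop κ z n s ω = Complex.normSq (centredMap (sleDriving κ ω) s z) := by
  rw [slePointNormSqStop, slePointReStop_eq_of_le h, slePointImStop_eq_of_le h,
    slePointIm_of_lt (coe_lt_swallowingTime_of_le_locTime hz h), Complex.normSq_apply, slePointRe]
  ring

/-- `X₀ = re z`. [folklore] -/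
theorem slePointReStop_zero (hz : 0 < z.im) (ω : ℝ≥0 → ℝ) : slePointReStop κ z n 0 ω = z.re := by
  have hzW : z ≠ sleDriving κ ω 0 := ne_driving_of_im_pos hz 0
  have h0 : ((0 : ℝ≥0) : WithTop ℝ≥0) ≤ slePointLocTime κ z n ω := by simp
  rw [slePointReStop_eq_of_le h0, slePointRe_apply, sleMap,
    map_zero_apply (continuous_sleDriving κ ω) hzW, sleDriving_zero, sub_zero]

/-- `Y₀ = im z`. [folklore] -/
theorem slePointImStop_zero (hz : 0 < z.im) (ω : ℝ≥0 → ℝ) : slePointImStop κ z n 0 ω = z.im := by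
  have h0 : ((0 : ℝ≥0) : WithTop ℝ≥0) ≤ slePointLocTime κ z n ω := by simp
  rw [slePointImStop_eq_of_le h0, slePointIm_apply, imFlowStop_zero (continuous_sleDriving κ ω) hz]

/-! ### Bounds -/

/-- `im z/(n+2) ≤ Y`. [folklore] -/
theorem level_le_slePointImStop (hz : 0 < z.im) (t : ℝ≥0) (ω : ℝ≥0 → ℝ) :
    z.im / (n + 2) ≤ slePointImStop κ z n t ω :=
  level_le_slePointIm hz (slePointClock_le_locTime t ω)

/-- `0 < Y`. [folklore] -/
theorem slePointImStop_pos (hz : 0 < z.im) (t : ℝ≥0) (ω : ℝ≥0 → ℝ) : 0 < slePointImStop κ z n t ω :=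
  (level_pos_lt hz n).1.trans_le (level_le_slePointImStop hz t ω)

/-- `Y ≤ im z`. [folklore] -/
theorem slePointImStop_le (hz : 0 < z.im) (t : ℝ≥0) (ω : ℝ≥0 → ℝ) : slePointImStop κ z n t ω ≤ z.im :=
  imFlowStop_le (continuous_sleDriving κ ω) hz _

/-- `(im z/(n+2))² ≤ Q`. [folklore] -/
theorem sq_level_le_slePointNormSqStop (hz : 0 < z.im) (t : ℝ≥0) (ω : ℝ≥0 → ℝ) :
    (z.im / (n + 2)) ^ 2 ≤ slePointNormSqStop κ z n t ω := by
  have h := level_le_slePointImStop hz t ω (κ := κ) (n := n)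
  have h0 : 0 ≤ z.im / (n + 2) := (level_pos_lt hz n).1.le
  rw [slePointNormSqStop]
  nlinarith [sq_nonneg (slePointReStop κ z n t ω)]

/-- `0 < Q`. [folklore] -/
theorem slePointNormSqStop_pos (hz : 0 < z.im) (t : ℝ≥0) (ω : ℝ≥0 → ℝ) :
    0 < slePointNormSqStop κ z n t ω :=
  (pow_pos (level_pos_lt hz n).1 2).trans_le (sq_level_le_slePointNormSqStop hz t ω)

/-- `Y² ≤ Q`. [folklore] -/
theorem sq_slePointImStop_le (t : ℝ≥0) (ω : ℝ≥0 → ℝ) :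
    slePointImStop κ z n t ω ^ 2 ≤ slePointNormSqStop κ z n t ω := by
  rw [slePointNormSqStop]; nlinarith [sq_nonneg (slePointReStop κ z n t ω)]

/-- AM–GM: `2|X| Y ≤ Q`, i.e. `|2X/Q| ≤ 1/Y`. [folklore] -/
theorem abs_two_mul_slePointReStop_div_normSq_le (hz : 0 < z.im) (t : ℝ≥0) (ω : ℝ≥0 → ℝ) :
    |2 * slePointReStop κ z n t ω / slePointNormSqStop κ z n t ω| ≤ (slePointImStop κ z n t ω)⁻¹ := by
  have hY := slePointImStop_pos hz t ω (κ := κ) (n := n)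
  have hQ := slePointNormSqStop_pos hz t ω (κ := κ) (n := n)
  rw [abs_div, abs_of_pos hQ, div_le_iff₀ hQ, abs_mul, abs_two]
  rw [slePointNormSqStop] at hQ ⊢
  have key : 2 * |slePointReStop κ z n t ω| * slePointImStop κ z n t ω ≤
      slePointReStop κ z n t ω ^ 2 + slePointImStop κ z n t ω ^ 2 := by
    nlinarith [sq_nonneg (|slePointReStop κ z n t ω| - slePointImStop κ z n t ω),
      sq_abs (slePointReStop κ z n t ω)]
  calc 2 * |slePointReStop κ z n t ω|
      = 2 * |slePointReStop κ z n t ω| * slePointImStop κ z n t ω * (slePointImStop κ z n t ω)⁻¹ := by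
        field_simp
    _ ≤ (slePointReStop κ z n t ω ^ 2 + slePointImStop κ z n t ω ^ 2) * (slePointImStop κ z n t ω)⁻¹ :=
        mul_le_mul_of_nonneg_right key (inv_nonneg.2 hY.le)
    _ = (slePointImStop κ z n t ω)⁻¹ * (slePointReStop κ z n t ω ^ 2 + slePointImStop κ z n t ω ^ 2) := by
        ring

/-- The inverse level `(n+2)/im z` bounds `1/Y`. [folklore] -/
theorem inv_slePointImStop_le (hz : 0 < z.im) (t : ℝ≥0) (ω : ℝ≥0 → ℝ) :
    (slePointImStop κ z n t ω)⁻¹ ≤ (n + 2) / z.im := by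
  have h := level_le_slePointImStop hz t ω (κ := κ) (n := n)
  have hl := (level_pos_lt hz n).1
  calc (slePointImStop κ z n t ω)⁻¹ ≤ (z.im / (n + 2))⁻¹ := inv_anti₀ hl h
    _ = (n + 2) / z.im := by rw [inv_div]

/-- **Bound on the drift of `x`**: `|𝟙 2X/Q| ≤ (n+2)/im z`. [folklore] -/
theorem abs_slePointReDrift_le (hz : 0 < z.im) (t : ℝ≥0) (ω : ℝ≥0 → ℝ) :
    |slePointReDrift κ z n t ω| ≤ (n + 2) / z.im := by
  rw [slePointReDrift, trunc_apply]
  split_ifs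
  · exact (abs_two_mul_slePointReStop_div_normSq_le hz t ω).trans (inv_slePointImStop_le hz t ω)
  · rw [abs_zero]; exact div_nonneg (by positivity) hz.le

/-- **Bound on the rate of `1/y`**: `|𝟙 2/(Y Q)| ≤ 2 ((n+2)/im z)³`. [folklore] -/
theorem abs_slePointInvImRate_le (hz : 0 < z.im) (t : ℝ≥0) (ω : ℝ≥0 → ℝ) :
    |slePointInvImRate κ z n t ω| ≤ 2 * ((n + 2) / z.im) ^ 3 := by
  have hY := slePointImStop_pos hz t ω (κ := κ) (n := n)
  have hQ := slePointNormSqStop_pos hz t ω (κ := κ) (n := n)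
  have hl := (level_pos_lt hz n).1
  have hIY := inv_slePointImStop_le hz t ω (κ := κ) (n := n)
  have hIQ : (slePointNormSqStop κ z n t ω)⁻¹ ≤ ((n + 2) / z.im) ^ 2 := by
    calc (slePointNormSqStop κ z n t ω)⁻¹ ≤ ((z.im / (n + 2)) ^ 2)⁻¹ :=
          inv_anti₀ (pow_pos hl 2) (sq_level_le_slePointNormSqStop hz t ω)
      _ = ((n + 2) / z.im) ^ 2 := by rw [← inv_pow, inv_div]
  rw [slePointInvImRate, trunc_apply]
  split_ifs
  · rw [abs_of_pos (div_pos two_pos (mul_pos hY hQ)), div_eq_mul_inv, mul_inv]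
    have h0 : 0 ≤ (n + 2) / z.im := div_nonneg (by positivity) hz.le
    calc 2 * ((slePointImStop κ z n t ω)⁻¹ * (slePointNormSqStop κ z n t ω)⁻¹)
        ≤ 2 * ((n + 2) / z.im * ((n + 2) / z.im) ^ 2) := by
          gcongr
      _ = 2 * ((n + 2) / z.im) ^ 3 := by ring
  · rw [abs_zero]; positivity

/-- **Bound on the ratio rate**: `0 ≤ 𝟙 4Y²/Q² ≤ 4 ((n+2)/im z)²`. [folklore] -/
theorem slePointRatioRate_nonneg (t : ℝ≥0) (ω : ℝ≥0 → ℝ) : 0 ≤ slePointRatioRate κ z n t ω := by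
  rw [slePointRatioRate, trunc_apply]
  split_ifs
  · positivity
  · exact le_rfl

/-- See `slePointRatioRate_nonneg`. [folklore] -/
theorem slePointRatioRate_le (hz : 0 < z.im) (t : ℝ≥0) (ω : ℝ≥0 → ℝ) :
    slePointRatioRate κ z n t ω ≤ 4 * ((n + 2) / z.im) ^ 2 := by
  have hQ := slePointNormSqStop_pos hz t ω (κ := κ) (n := n)
  have hl := (level_pos_lt hz n).1
  rw [slePointRatioRate, trunc_apply]
  split_ifs
  · -- `4Y²/Q² ≤ 4/Q ≤ 4 (level⁻¹)²`
    have h1 : 4 * slePointImStop κ z n t ω ^ 2 / slePointNormSqStop κ z n t ω ^ 2 ≤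
        4 / slePointNormSqStop κ z n t ω := by
      rw [div_le_div_iff₀ (pow_pos hQ 2) hQ]
      have := sq_slePointImStop_le t ω (κ := κ) (z := z) (n := n)
      nlinarith
    have h2 : 4 / slePointNormSqStop κ z n t ω ≤ 4 / (z.im / (n + 2)) ^ 2 :=
      div_le_div_of_nonneg_left (by norm_num) (pow_pos hl 2) (sq_level_le_slePointNormSqStop hz t ω)
    calc _ ≤ 4 / (z.im / (n + 2)) ^ 2 := h1.trans h2
      _ = 4 * ((n + 2) / z.im) ^ 2 := by rw [div_pow, div_pow, div_div_eq_mul_div]; ring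
  · positivity

/-- The diffusion coefficient is bounded by `√κ`. [folklore] -/
theorem abs_slePointDiffusion_le (t : ℝ≥0) (ω : ℝ≥0 → ℝ) : |slePointDiffusion κ z n t ω| ≤ Real.sqrt κ := by
  rw [slePointDiffusion, trunc_apply]
  split_ifs
  · rw [abs_neg, abs_of_nonneg (Real.sqrt_nonneg _)]
  · rw [abs_zero]; exact Real.sqrt_nonneg _

/-! ### Continuity of paths -/

/-- `X` has continuous paths (`x` is continuous before `τ(z) > ρₙ`). [folklore] -/
theorem continuous_slePointReStop (hz : 0 < z.im) (ω : ℝ≥0 → ℝ) :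
    Continuous fun t ↦ slePointReStop κ z n t ω := by
  have h := (continuousOn_slePointRe (κ := κ) hz ω).comp_continuous
    (continuous_untopA_min_coe (slePointLocTime κ z n ω))
    (fun t ↦ slePointClock_lt_swallowingTime hz t ω)
  exact h

/-- `Y` has continuous paths. [folklore] -/
theorem continuous_slePointImStop (hz : 0 < z.im) (ω : ℝ≥0 → ℝ) :
    Continuous fun t ↦ slePointImStop κ z n t ω :=
  continuous_stoppedProcess_path (u := slePointIm κ z) (continuous_slePointIm hz ω) _

/-- `Q` has continuous paths. [folklore] -/
theorem continuous_slePointNormSqStop (hz : 0 < z.im) (ω : ℝ≥0 → ℝ) :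
    Continuous fun t ↦ slePointNormSqStop κ z n t ω :=
  ((continuous_slePointReStop hz ω).pow 2).add ((continuous_slePointImStop hz ω).pow 2)

/-- The untruncated drift `2X/Q` has continuous paths. [folklore] -/
theorem continuous_slePointReDrift_untrunc (hz : 0 < z.im) (ω : ℝ≥0 → ℝ) :
    Continuous fun t ↦ 2 * slePointReStop κ z n t ω / slePointNormSqStop κ z n t ω :=
  (continuous_const.mul (continuous_slePointReStop hz ω)).div (continuous_slePointNormSqStop hz ω)
    fun t ↦ (slePointNormSqStop_pos hz t ω).ne'

/-- The untruncated rate `2/(Y Q)` has continuous paths. [folklore] -/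
theorem continuous_slePointInvImRate_untrunc (hz : 0 < z.im) (ω : ℝ≥0 → ℝ) :
    Continuous fun t ↦ 2 / (slePointImStop κ z n t ω * slePointNormSqStop κ z n t ω) :=
  continuous_const.div ((continuous_slePointImStop hz ω).mul (continuous_slePointNormSqStop hz ω))
    fun t ↦ mul_ne_zero (slePointImStop_pos hz t ω).ne' (slePointNormSqStop_pos hz t ω).ne'

/-- The untruncated ratio rate `4Y²/Q²` has continuous paths. [folklore] -/
theorem continuous_slePointRatioRate_untrunc (hz : 0 < z.im) (ω : ℝ≥0 → ℝ) :
    Continuous fun t ↦ 4 * slePointImStop κ z n t ω ^ 2 / slePointNormSqStop κ z n t ω ^ 2 :=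
  (continuous_const.mul ((continuous_slePointImStop hz ω).pow 2)).div
    ((continuous_slePointNormSqStop hz ω).pow 2) fun t ↦ pow_ne_zero 2 (slePointNormSqStop_pos hz t ω).ne'

/-- The truncated coefficients are locally integrable in time along every path. [folklore] -/
theorem integrableOn_slePointReDrift (hz : 0 < z.im) (ω : ℝ≥0 → ℝ) (t : ℝ≥0) :
    IntegrableOn (fun s : ℝ ↦ slePointReDrift κ z n s.toNNReal ω) (Icc 0 t) :=
  integrableOn_trunc (((continuous_slePointReDrift_untrunc hz ω).comp
    continuous_real_toNNReal).continuousOn.integrableOn_compact isCompact_Icc)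

/-- See `integrableOn_slePointReDrift`. [folklore] -/
theorem integrableOn_slePointInvImRate (hz : 0 < z.im) (ω : ℝ≥0 → ℝ) (t : ℝ≥0) :
    IntegrableOn (fun s : ℝ ↦ slePointInvImRate κ z n s.toNNReal ω) (Icc 0 t) :=
  integrableOn_trunc (((continuous_slePointInvImRate_untrunc hz ω).comp
    continuous_real_toNNReal).continuousOn.integrableOn_compact isCompact_Icc)

/-- See `integrableOn_slePointReDrift`. [folklore] -/
theorem integrableOn_slePointRatioRate (hz : 0 < z.im) (ω : ℝ≥0 → ℝ) (t : ℝ≥0) :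
    IntegrableOn (fun s : ℝ ↦ slePointRatioRate κ z n s.toNNReal ω) (Icc 0 t) :=
  integrableOn_trunc (((continuous_slePointRatioRate_untrunc hz ω).comp
    continuous_real_toNNReal).continuousOn.integrableOn_compact isCompact_Icc)

/-! ### Measurability -/

/-- `{ρₙ < t} ∈ 𝓕ᵂ_t` (optionality of the stopping time `ρₙ`). [folklore] -/
theorem measurableSet_locTime_lt (κ : ℝ≥0) (hz : 0 < z.im) (n : ℕ) (t : ℝ≥0) :
    MeasurableSet[brownianFiltration t] {ω | slePointLocTime κ z n ω < t} :=
  (isStoppingTime_slePointLocTime κ hz n).measurableSet_lt t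

/-- `X` is strongly adapted (progressive `x`, stopping time `ρₙ`). [folklore] -/
theorem stronglyAdapted_slePointReStop (κ : ℝ≥0) (hz : 0 < z.im) (n : ℕ) :
    StronglyAdapted brownianFiltration (slePointReStop κ z n) :=
  (isStronglyProgressive_slePointRe κ hz).stronglyAdapted_stoppedProcess
    (isStoppingTime_slePointLocTime κ hz n)

/-- `Y` is strongly adapted. [folklore] -/
theorem stronglyAdapted_slePointImStop (κ : ℝ≥0) (hz : 0 < z.im) (n : ℕ) :
    StronglyAdapted brownianFiltration (slePointImStop κ z n) :=
  (isStronglyProgressive_slePointIm κ hz).stronglyAdapted_stoppedProcess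
    (isStoppingTime_slePointLocTime κ hz n)

/-- `X` is progressive. [folklore] -/
theorem isStronglyProgressive_slePointReStop (κ : ℝ≥0) (hz : 0 < z.im) (n : ℕ) :
    IsStronglyProgressive brownianFiltration (slePointReStop κ z n) :=
  (stronglyAdapted_slePointReStop κ hz n).isStronglyProgressive_of_continuous
    (continuous_slePointReStop hz)

/-- `Y` is progressive. [folklore] -/
theorem isStronglyProgressive_slePointImStop (κ : ℝ≥0) (hz : 0 < z.im) (n : ℕ) :
    IsStronglyProgressive brownianFiltration (slePointImStop κ z n) :=
  (stronglyAdapted_slePointImStop κ hz n).isStronglyProgressive_of_continuous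
    (continuous_slePointImStop hz)

/-- `Q` is progressive. [folklore] -/
theorem isStronglyProgressive_slePointNormSqStop (κ : ℝ≥0) (hz : 0 < z.im) (n : ℕ) :
    IsStronglyProgressive brownianFiltration (slePointNormSqStop κ z n) := by
  have hX := isStronglyProgressive_slePointReStop κ hz n
  have hY := isStronglyProgressive_slePointImStop κ hz n
  have hX2 : IsStronglyProgressive brownianFiltration fun s ω ↦ slePointReStop κ z n s ω ^ 2 :=
    IsStronglyProgressive.continuous_comp hX (continuous_pow 2)
  have hY2 : IsStronglyProgressive brownianFiltration fun s ω ↦ slePointImStop κ z n s ω ^ 2 :=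
    IsStronglyProgressive.continuous_comp hY (continuous_pow 2)
  exact hX2.add hY2

/-- The drift of `x` is progressive. [folklore] -/
theorem isStronglyProgressive_slePointReDrift (κ : ℝ≥0) (hz : 0 < z.im) (n : ℕ) :
    IsStronglyProgressive brownianFiltration (slePointReDrift κ z n) := by
  have hX := isStronglyProgressive_slePointReStop κ hz n
  have hQ := isStronglyProgressive_slePointNormSqStop κ hz n
  refine isStronglyProgressive_trunc ?_ (measurableSet_locTime_lt κ hz n)
  have hQi : IsStronglyProgressive brownianFiltration fun s ω ↦ (slePointNormSqStop κ z n s ω)⁻¹ :=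
    fun i ↦ ((hQ i).measurable.inv).stronglyMeasurable
  have h2X : IsStronglyProgressive brownianFiltration fun s ω ↦ 2 * slePointReStop κ z n s ω :=
    (isStronglyProgressive_const _ _).mul hX
  simpa [div_eq_mul_inv] using h2X.mul hQi

/-- The diffusion coefficient is progressive. [folklore] -/
theorem isStronglyProgressive_slePointDiffusion (κ : ℝ≥0) (hz : 0 < z.im) (n : ℕ) :
    IsStronglyProgressive brownianFiltration (slePointDiffusion κ z n) :=
  isStronglyProgressive_trunc (isStronglyProgressive_const _ _) (measurableSet_locTime_lt κ hz n)

/-- The rate of `1/y` is progressive. [folklore] -/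
theorem isStronglyProgressive_slePointInvImRate (κ : ℝ≥0) (hz : 0 < z.im) (n : ℕ) :
    IsStronglyProgressive brownianFiltration (slePointInvImRate κ z n) := by
  have hY := isStronglyProgressive_slePointImStop κ hz n
  have hQ := isStronglyProgressive_slePointNormSqStop κ hz n
  refine isStronglyProgressive_trunc ?_ (measurableSet_locTime_lt κ hz n)
  have hYQi : IsStronglyProgressive brownianFiltration
      fun s ω ↦ (slePointImStop κ z n s ω * slePointNormSqStop κ z n s ω)⁻¹ :=
    fun i ↦ (((hY.mul hQ) i).measurable.inv).stronglyMeasurable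
  simpa [div_eq_mul_inv] using (isStronglyProgressive_const _ (2 : ℝ)).mul hYQi

/-- The ratio rate is progressive. [folklore] -/
theorem isStronglyProgressive_slePointRatioRate (κ : ℝ≥0) (hz : 0 < z.im) (n : ℕ) :
    IsStronglyProgressive brownianFiltration (slePointRatioRate κ z n) := by
  have hY := isStronglyProgressive_slePointImStop κ hz n
  have hQ := isStronglyProgressive_slePointNormSqStop κ hz n
  refine isStronglyProgressive_trunc ?_ (measurableSet_locTime_lt κ hz n)
  have hY2 : IsStronglyProgressive brownianFiltration fun s ω ↦ 4 * slePointImStop κ z n s ω ^ 2 :=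
    (isStronglyProgressive_const _ _).mul (IsStronglyProgressive.continuous_comp hY (continuous_pow 2))
  have hQ2i : IsStronglyProgressive brownianFiltration fun s ω ↦ (slePointNormSqStop κ z n s ω ^ 2)⁻¹ :=
    fun i ↦ (((IsStronglyProgressive.continuous_comp hQ (continuous_pow 2)) i).measurable.inv).stronglyMeasurable
  simpa [div_eq_mul_inv] using hY2.mul hQ2i

end Literature.Probability.RandomPlanarGeometry
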